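import Mathlib
import HarnessLib
import Literature.MathematicalPhysics.QuantumFieldTheory.GaussianQuadraticMGF
import Literature.Analysis.Matrix.DetOneSubTraceBound

/-!
# One Gaussian step of a quadratic large-field weight
# (Adams–Buchholz–Kotecký–Müller, Ch. 7.1 (7.5)/(7.8) and Lemma 7.7 (ii))

The weak-norm weights of [ABKM19] are exponentials of quadratic forms, `w_k^X(φ) = e^{½(A_k^X φ, φ)}`,
and the weight "between the scales `k` and `k+1`" is defined by one Gaussian integration step
([ABKM19] (7.5)): `A_{k:k+1}^X = ((A_k^X)^{−1} − (1+ζ') C_{k+1})^{−1}` — "The definition … is a bit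
sloppy because `A_k^X` is in general not invertible" (loc. cit.).  The invertibility-free form of
the same operator is

`nextForm A C = A + A √C (1 − √C A √C)⁻¹ √C A`

(for invertible `A` and `A < C⁻¹` both equal `Σ_n A (CA)^n`), and with it the Gaussian calculus
identity (7.8) reads, for EVERY covariance `C` (degenerate allowed) and every symmetric `A` with
`1 − √C A √C` positive definite,

`∫ e^{½ (A(φ+ψ), φ+ψ)} N(0,C)(dψ) = det(1 − √C A √C)^{−1/2} · e^{½ (nextForm A C φ, φ)}`

(`integral_exp_half_quadForm_shift_eq_nextForm`), and together with the "standard estimate for the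
determinant" (`Literature.Analysis.Matrix.det_one_sub_rpow_neg_half_le`) the INTEGRATION PROPERTY in
the shape of [ABKM19] Lemma 7.7 (ii) / Theorem 7.1 (w7):

`0 ⪯ √C A √C ⪯ θ·1`, `θ < 1` ⇒ `∫ e^{½(A(φ+ψ),φ+ψ)} N(0,C)(dψ) ≤ (1−θ)^{−tr(√CA√C)/(2θ)} e^{½(nextForm A C φ, φ)}`

(`integral_exp_half_quadForm_shift_le`).  Everything is proved; no named fact.

What is NOT here: the specific operators `A_k^X` of [ABKM19] (7.5) (built from `M_k^X`, `δ_k` and the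
finite-range decomposition), the trace estimate `tr(√C A_k^X √C) ≤ C|X|_k` of Lemma 7.7 (i), and the
monotonicity of `nextForm` in `A` and `C`.

## References
* S. Adams, S. Buchholz, R. Kotecký, S. Müller, arXiv:1910.13564, Ch. 7.1 (7.5), (7.8); Lemma 7.7
  [AdamsBuchholzKoteckyMuller2019].
-/

noncomputable section

open MeasureTheory ProbabilityTheory WithLp Matrix
open scoped ENNReal Matrix MatrixOrder

namespace Literature.MathematicalPhysics.StatisticalMechanics.GradientRG

open Literature.MathematicalPhysics.QuantumFieldTheory

variable {ι : Type*} [Fintype ι] [DecidableEq ι]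

/-- **The next-scale quadratic form** `nextForm A C = A + A √C (1 − √C A √C)⁻¹ √C A` — the
invertibility-free form of [ABKM19] (7.5)'s `(A⁻¹ − C)⁻¹` (`√C = CFC.sqrt C`).
[cite: AdamsBuchholzKoteckyMuller2019, Ch. 7.1 (7.5)] -/
def nextForm (A C : Matrix ι ι ℝ) : Matrix ι ι ℝ :=
  A + A * CFC.sqrt C * ((1 : Matrix ι ι ℝ) - CFC.sqrt C * A * CFC.sqrt C)⁻¹ * CFC.sqrt C * A

/-- The exponent produced by the Gaussian step is the quadratic form of `nextForm`:
`φᵀAφ + (√C Aφ)ᵀ (1 − √CA√C)⁻¹ (√C Aφ) = φᵀ (nextForm A C) φ` for symmetric `A`.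
[cite: AdamsBuchholzKoteckyMuller2019, Ch. 7.1 (7.8)] -/
theorem quadForm_nextForm {A : Matrix ι ι ℝ} (hA : A.IsSymm) (C : Matrix ι ι ℝ) (φ : ι → ℝ) :
    φ ⬝ᵥ nextForm A C *ᵥ φ =
      φ ⬝ᵥ A *ᵥ φ + (CFC.sqrt C *ᵥ (A *ᵥ φ)) ⬝ᵥ
        ((1 : Matrix ι ι ℝ) - CFC.sqrt C * A * CFC.sqrt C)⁻¹ *ᵥ (CFC.sqrt C *ᵥ (A *ᵥ φ)) := by
  have hAt : Aᵀ = A := hA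
  have hRt : (CFC.sqrt C)ᵀ = CFC.sqrt C := GaussianToolkit.transpose_sqrt (S := C)
  rw [nextForm, Matrix.add_mulVec, dotProduct_add]
  congr 1
  -- `φᵀ (A √C M √C A) φ = (√C A φ)ᵀ M (√C A φ)`
  rw [← Matrix.mulVec_mulVec, ← Matrix.mulVec_mulVec, ← Matrix.mulVec_mulVec,
    ← Matrix.mulVec_mulVec, Matrix.dotProduct_mulVec φ A, ← Matrix.mulVec_transpose, hAt,
    Matrix.dotProduct_mulVec (A *ᵥ φ) (CFC.sqrt C), ← Matrix.mulVec_transpose, hRt]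

/-- **[ABKM19] (7.8) with the next-scale form**: for every real matrix `C` (Mathlib's `N(0,C)`),
every symmetric `A` with `1 − √C A √C` positive definite and every `φ`,
`∫ e^{½(A(φ+ψ),φ+ψ)} N(0,C)(dψ) = (√det(1 − √C A √C))⁻¹ · e^{½ (nextForm A C φ, φ)}`.
[cite: AdamsBuchholzKoteckyMuller2019, Ch. 7.1 (7.8)] -/
theorem integral_exp_half_quadForm_shift_eq_nextForm (C : Matrix ι ι ℝ) {A : Matrix ι ι ℝ}
    (hA : A.IsSymm) (hCA : ((1 : Matrix ι ι ℝ) - CFC.sqrt C * A * CFC.sqrt C).PosDef)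
    (φ : ι → ℝ) :
    ∫ ψ, Real.exp ((1/2 : ℝ) * ((φ + ofLp ψ) ⬝ᵥ A *ᵥ (φ + ofLp ψ)))
        ∂(multivariateGaussian 0 C) =
      (Real.sqrt ((1 : Matrix ι ι ℝ) - CFC.sqrt C * A * CFC.sqrt C).det)⁻¹ *
        Real.exp ((1/2 : ℝ) * (φ ⬝ᵥ nextForm A C *ᵥ φ)) := by
  rw [integral_exp_half_quadForm_shift_multivariateGaussian C hA hCA φ, quadForm_nextForm hA C φ,
    mul_add]

/-- **Integration property of a quadratic weight** (shape of [ABKM19] Lemma 7.7 (ii) /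
Theorem 7.1 (w7)): if `A` is symmetric and `0 ⪯ √C A √C ⪯ θ·1` with `0 < θ < 1`, then
`∫ e^{½(A(φ+ψ),φ+ψ)} N(0,C)(dψ) ≤ (1 − θ)^{−tr(√C A √C)/(2θ)} · e^{½ (nextForm A C φ, φ)}`.
[cite: AdamsBuchholzKoteckyMuller2019, Lemma 7.7 (ii)] -/
theorem integral_exp_half_quadForm_shift_le (C : Matrix ι ι ℝ) {A : Matrix ι ι ℝ} (hA : A.IsSymm)
    {θ : ℝ} (hθ0 : 0 < θ) (hθ1 : θ < 1) (hB0 : (CFC.sqrt C * A * CFC.sqrt C).PosSemidef)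
    (hBθ : (θ • (1 : Matrix ι ι ℝ) - CFC.sqrt C * A * CFC.sqrt C).PosSemidef) (φ : ι → ℝ) :
    ∫ ψ, Real.exp ((1/2 : ℝ) * ((φ + ofLp ψ) ⬝ᵥ A *ᵥ (φ + ofLp ψ)))
        ∂(multivariateGaussian 0 C) ≤
      (1 - θ) ^ (-((CFC.sqrt C * A * CFC.sqrt C).trace / (2 * θ))) *
        Real.exp ((1/2 : ℝ) * (φ ⬝ᵥ nextForm A C *ᵥ φ)) := by
  set B : Matrix ι ι ℝ := CFC.sqrt C * A * CFC.sqrt C with hB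
  -- `1 − B` is positive definite: `1 − B = (1 − θ)·1 + (θ·1 − B)` with `1 − θ > 0`
  have h1B : ((1 : Matrix ι ι ℝ) - B).PosDef := by
    have h : (1 : Matrix ι ι ℝ) - B = (1 - θ) • (1 : Matrix ι ι ℝ) + (θ • (1 : Matrix ι ι ℝ) - B) := by
      rw [sub_smul, one_smul]; abel
    rw [h]
    exact (Matrix.PosDef.one.smul (by linarith)).add_posSemidef hBθ
  rw [integral_exp_half_quadForm_shift_eq_nextForm C hA h1B φ]
  refine mul_le_mul_of_nonneg_right ?_ (Real.exp_pos _).le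
  have hdet : 0 < ((1 : Matrix ι ι ℝ) - B).det := h1B.det_pos
  have hsqrt : (Real.sqrt ((1 : Matrix ι ι ℝ) - B).det)⁻¹ = ((1 : Matrix ι ι ℝ) - B).det ^ (-(1/2 : ℝ)) := by
    rw [Real.sqrt_eq_rpow, ← Real.rpow_neg hdet.le]
  rw [hsqrt]
  exact Literature.Analysis.Matrix.det_one_sub_rpow_neg_half_le hB0 hθ0 hθ1 hBθ

end Literature.MathematicalPhysics.StatisticalMechanics.GradientRG

end
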